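import Literature.NumberTheory.EllipticCurves.Kobayashi2003.SignedKatoDivisibility
import Literature.NumberTheory.EllipticCurves.Kobayashi2003.SignedSelmerRankBoundProofs
import Literature.NumberTheory.EllipticCurves.Kobayashi2003.SignedSelmerDualExistsProofs
import Literature.NumberTheory.EllipticCurves.PlusMinusPAdicLFunctionProofs
import HarnessLib

/-!
# Kobayashi 2003, Theorem 9.4: `ord_{X=0} L_p^±(E, X) ≥ rank E(ℚ)` at a supersingular prime with `a_p = 0` — "half of the `p`-adic Birch and Swinnerton-Dyer conjecture", PROVED modulo the tree's Kobayashi facts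

Topic `Literature/NumberTheory/EllipticCurves`, cluster `Kobayashi2003`. Companion ("Proofs") file —
theorems only, no definition, no new named fact (D-0026) — to `SignedKatoDivisibility.lean` (named
fact `thm41_signedCharIdeal_divisibility`, Kobayashi's Thm. 1.3/4.1: `pⁿ L_p^ε ∈ Char(X^ε)`),
`SignedSelmerTorsion.lean` (named fact `thm12_signedSelmerDual_finite_torsion`, Thm. 1.2) and
`SignedSelmerRankBoundProofs.lean` (PROVED: `rank E(ℚ) ≤ ord_{T=0} f` for every `f ∈ Char(X^ε)`,
Greenberg's Lemma 3.1 on the signed Selmer group — the easy half of control). HONEST FRAMING (cell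
`bsd-rank2`, D-0036, lane p2 «kernel audit» of «rank ≤ ord_T L_p for every `E` and every `p`»):
this file settles the SUPERSINGULAR row (`a_p = 0`, e.g. every supersingular `p ≥ 5`) of that table
as a tree theorem modulo published facts, next to the good-ordinary row (`KatoRankBound*`) and the
multiplicative row (`KatoRankBoundMultiplicativeProofs`). Nothing here reads an analytic rank.

**Source, as printed** (held `paper:doi-10-1007-s00222-002-0265-4`, journal pagination = page):
S. Kobayashi, *Iwasawa theory for elliptic curves at supersingular primes*, Invent. Math. 152 (2003)
1–36; standing hypotheses pp. 1–2 ("Let `p` be an odd prime … `E` an elliptic curve over `ℚ` with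
good supersingular reduction at `p`. Suppose `a_p = 0`"); §9, p. 27: "The following is half of the
`p`-adic Birch and Swinnerton-Dyer conjecture, which is already proved in Kato [7].
**Theorem 9.4.** `ord_{X=0} L_p^±(E, X) ≥ rank E(ℚ)`. In particular, we have
`ord_{X=0} L_p(E, X) ≥ rank E(ℚ)`. *Proof.* By Theorem 9.3, we have a pseudo-isomorphism
`X^{±}_∞/(γ - 1)X^{±}_∞ ≅ X^{±}_0 = X_0`. We compare the `ℤ_p`-rank of the both sides. By the half
of the even (odd) main conjecture [Thm. 1.3/4.1], the rank of the left hand side is less than or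
equal to `ord_{X=0} L_p^±(E, X)`, and the rank of the right hand side is greater than or equal to
the rank of `E(ℚ)`." Here `L_p^±(E, X) ∈ ℤ_p⟦X⟧` are Pollack's signed `p`-adic `L`-functions in
Kobayashi's labelling (Thm. 3.2, p. 7; tree predicate `IsSignedPAdicLFunction f p ε L`, EXISTENCE a
tree theorem: `pollack_exists_plusMinusPAdicLFunction_holds`, `exists_isSignedPAdicLFunction`).

**What is proved here.** Kobayashi's proof verbatim, with the control theorem 9.3 replaced by its
easy half (which is all the inequality needs): for the cyclotomic `ℤ_p`-extension `κ` with
topological generator `γ` matching the cyclotomic variable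
(`exists_isCyclotomic_isTopGenerator_isCyclotomicVariable_holds`) and a Pontryagin-dual datum `D` of
`Sel^ε(E/ℚ_∞)` (`nonempty_signedSelmerDualData`), Thm. 1.2 (fact `h12`) makes `X^ε = D.X` finitely
generated and torsion, Thm. 4.1 (fact `h41`, its image-free clause) gives `pⁿ · L_p^ε ∈ Char(X^ε)`,
`SignedSelmerDualData.mordellWeilRank_le_order_of_mem_charIdeal` gives
`rank E(ℚ) ≤ ord_{T=0}(pⁿ · L_p^ε)`, and `ord_{T=0}(pⁿ · L) = ord_{T=0} L` in `ℤ_p⟦T⟧`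
(`order_natCast_pow_mul`). No hypothesis on the Galois image is needed.

* `thm94_mordellWeilRank_le_order` (**proved** mod `h41`, `h12`): for `W` globally minimal, `p ≠ 2`
  of good reduction with `a_p = 0`, `f` the newform of `W`, either sign `ε`, and every `L` which is
  Pollack's `L_p^ε(E, X)`: `rank E(ℚ) ≤ ord_{X=0} L`.
* `thm94_exists_signedPAdicLFunction_mordellWeilRank_le_order` (**proved** mod `h41`, `h12`): the
  same with `L_p^ε` produced by the tree's Pollack existence theorem (`L ≠ 0`).
-- TODO(general form): the "In particular" `ord_{X=0} L_p(E, X) ≥ rank E(ℚ)` for the unsigned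
-- `L_p(E, α, X)` (`α² = -p`, slope ½, coefficients in `ℚ_p(α)`; `L_p = L_p^- log_p^+ + α L_p^+ log_p^-`,
-- Thm. 3.2) is not expressible with the tree's `padicLFunction f α`, `α : ℚ_[p]`; Kato's Thm. 18.4
-- (Astérisque 295, §18.1: any `α ∈ F_λ` with `ord_p(α) < k - 1`) prints it in that generality.

References: [Kobayashi2003] Thm. 1.2, Thm. 1.3 (p. 2), Thm. 3.2 (p. 7), Thm. 4.1 (p. 8), Thm. 9.3,
Thm. 9.4 (p. 27); [Kato2004Asterisque] §18.1 (p. 280), Thm. 18.4 (p. 281); [Pollack2003] Thm. 5.6,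
Prop. 6.18; [GreenbergLNM1716] §3 Lemma 3.1.
-/

set_option autoImplicit false

noncomputable section

open scoped MatrixGroups ModularForm

open CongruenceSubgroup Literature.NumberTheory.EllipticCurves
  Literature.NumberTheory.EllipticCurves.ModularForms

namespace Literature.NumberTheory.EllipticCurves.Kobayashi2003

/-- In `Λ = ℤ_p⟦T⟧`, multiplying by `pⁿ` does not change the order of vanishing at `T = 0`
(`ℤ_p` is a domain and `pⁿ ≠ 0` is a constant). [folklore] -/
private theorem order_natCast_pow_mul (p : ℕ) [Fact p.Prime] (n : ℕ) (L : IwasawaAlgebra p) :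
    PowerSeries.order ((p : IwasawaAlgebra p) ^ n * L) = PowerSeries.order L := by
  have hC : ((p : IwasawaAlgebra p) ^ n) = PowerSeries.C ((p : ℤ_[p]) ^ n) := by
    rw [map_pow, map_natCast]
  have hne : ((p : ℤ_[p]) ^ n) ≠ 0 := pow_ne_zero n (by exact_mod_cast (Fact.out : p.Prime).ne_zero)
  have h0 : PowerSeries.order ((p : IwasawaAlgebra p) ^ n) = 0 := by
    by_contra h
    have h' : ((p : IwasawaAlgebra p) ^ n).constantCoeff = 0 :=
      PowerSeries.order_ne_zero_iff_constCoeff_eq_zero.mp h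
    rw [hC, PowerSeries.constantCoeff_C] at h'
    exact hne h'
  rw [PowerSeries.order_mul, h0, zero_add]

section Thm94

variable (W : WeierstrassCurve ℚ) [W.IsElliptic] [W.IsGloballyMinimal] (p : ℕ) [Fact p.Prime]
  {N : ℕ} [NeZero N] {f : CuspForm (Gamma0 N) 2}

/-- **Kobayashi 2003, Theorem 9.4 (first display): `ord_{X=0} L_p^±(E, X) ≥ rank E(ℚ)`** — "half
of the `p`-adic Birch and Swinnerton-Dyer conjecture, which is already proved in Kato" — PROVED
modulo the tree's named facts `thm41_signedCharIdeal_divisibility` (`h41`, Thm. 1.3/4.1: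
`pⁿ L_p^ε ∈ Char(X^ε)`) and `thm12_signedSelmerDual_finite_torsion` (`h12`, Thm. 1.2). For `W`
globally minimal, `p ≠ 2` a prime of good reduction with `a_p = 0` (`hap`), `f` the newform of `W`,
either sign `ε`, and every `L ∈ Λ` which is Pollack's `L_p^ε(E, X)` (`IsSignedPAdicLFunction f p ε L`):
`rank E(ℚ) ≤ ord_{X=0} L`. Kobayashi's proof, with Thm. 9.3 (control) replaced by its easy half
`SignedSelmerDualData.mordellWeilRank_le_order_of_mem_charIdeal`; no Galois-image hypothesis
(the factor `pⁿ` of Thm. 4.1 does not change `ord_{X=0}`).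
[cite: Kobayashi2003, Thm. 9.4 (p. 27); Thm. 1.2, Thm. 4.1 (p. 8)]
[cite: Kato2004Asterisque, Thm. 18.4 (p. 281) with §18.1] -/
theorem thm94_mordellWeilRank_le_order (h41 : thm41_signedCharIdeal_divisibility)
    (h12 : thm12_signedSelmerDual_finite_torsion) (hp : p ≠ 2)
    (hgood : W.HasGoodReductionAtPrime p) (hap : W.frobeniusTrace p = 0) (hf : IsNewformOf W f)
    (ε : ℤˣ) {L : IwasawaAlgebra p} (hL : IsSignedPAdicLFunction f p ε L) :
    (W.mordellWeilRank : ℕ∞) ≤ PowerSeries.order L := by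
  obtain ⟨κ, hκ, γ, hγ, hγ'⟩ := exists_isCyclotomic_isTopGenerator_isCyclotomicVariable_holds p
  obtain ⟨D⟩ := nonempty_signedSelmerDualData W κ ε hγ
  haveI : Module.Finite (IwasawaAlgebra p) D.X := h12.moduleFinite hp hgood hap hκ hγ D
  have hX : Module.IsTorsion (IwasawaAlgebra p) D.X := h12.isTorsion hp hgood hap hκ hγ D
  obtain ⟨n, hmem⟩ :=
    thm41_signedCharIdeal_divisibility.rational h41 hp hgood hap hf hκ hγ hγ' hL D hX
  have hle := D.mordellWeilRank_le_order_of_mem_charIdeal hγ hX hmem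
  rwa [order_natCast_pow_mul] at hle

/-- **Theorem 9.4 with Pollack's `L_p^ε` supplied by the tree** (its existence is a tree THEOREM,
`pollack_exists_plusMinusPAdicLFunction_holds`; Kobayashi Thm. 3.2): under the hypotheses of
`thm94_mordellWeilRank_le_order` there IS a non-zero `L = L_p^ε(E, X) ∈ Λ` and
`rank E(ℚ) ≤ ord_{X=0} L`. [cite: Kobayashi2003, Thm. 9.4 (p. 27) and Thm. 3.2 (p. 7)]
[cite: Pollack2003, Thm. 5.6 and Prop. 6.18] -/
theorem thm94_exists_signedPAdicLFunction_mordellWeilRank_le_order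
    (h41 : thm41_signedCharIdeal_divisibility) (h12 : thm12_signedSelmerDual_finite_torsion)
    (hp : p ≠ 2) (hgood : W.HasGoodReductionAtPrime p) (hap : W.frobeniusTrace p = 0)
    (hf : IsNewformOf W f) (ε : ℤˣ) :
    ∃ L : IwasawaAlgebra p, L ≠ 0 ∧ IsSignedPAdicLFunction f p ε L ∧
      (W.mordellWeilRank : ℕ∞) ≤ PowerSeries.order L := by
  obtain ⟨L, hL0, hL⟩ :=
    exists_isSignedPAdicLFunction pollack_exists_plusMinusPAdicLFunction_holds hp hf hgood hap ε
  exact ⟨L, hL0, hL, thm94_mordellWeilRank_le_order W p h41 h12 hp hgood hap hf ε hL⟩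

end Thm94

end Literature.NumberTheory.EllipticCurves.Kobayashi2003

end
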